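import Summits.ValiantsHypothesis.ValiantsHypothesis.Theorems.LacunarySymmetroidMatrixDescartesStampFull013578

/-!
# `MatrixDescartes` — lines «finite» / «stamp»: BY-NAME CLOSERS for the typed search targets F7, G6 (and the state of G7)

HONEST FRAMING.  Object-search cell `pub-symmetroid`, seat val-sym-eng-3 g7, written on the desk's ruling (lead g27, 20:30Z rule):
ONE helper file restating, under the workfiles' stub names and in the Theorems-side vocabulary of `…FiniteSectorDefs`
(`FullyRealisable`, `pencil`, `IsFullPosRooted`, `dA5` — the workfile copies are verbatim, so the port seats close the stubs by
`exact` with δ-unfolding, pattern of F4/F5/F6), the kernel witnesses that ALREADY exist: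

* `Cruxes/MatrixDescartes/Lines/finite.lean` l.694 `stub_F7_two_six` (`∃ S, symm ∧ IsFullPosRooted det ∧ natDegree = 16` on
  `(0,1,3,5,7,8)`) ⟸ `fullyRealisable_two_013578_16` (val-sym-engine-7 g0, p609049) — `stub_F7_two_six_closer` below (the only declaration of this file:
  the stub's ∃-statement is NOT syntactically the landed `FullyRealisable 2 _ 16`, so a by-name restatement is a genuine closer);
* `Cruxes/MatrixDescartes/Lines/stamp.lean` l.178 `stub_G6 : FullyRealisable 2 dA5 16` IS ALREADY the landed `fullyRealisable_two_dA5_16`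
  (`…StampFull013578`) verbatim — the port closes it by `exact` with no helper (an alias here would be a `dedup.landed` restatement);
* `stamp.lean` l.182 `stub_G7 : FullyRealisable 2 dA6 20` with `dA6 = (0,1,3,5,7,9,10)` is **NOT closable by name**: the landed
  `ν(2,7) = 20` witness `fullyRealisable_two_01258910_20` (val-sym-engine-7 g1, p625585) lives on the DIFFERENT extremal basis
  `(0,1,2,5,8,9,10)` (`…StampFull01258910`); the planner may re-type G7 as a disjunction over the five extremal `A₆` (as G8/G9 are typed),
  or an engine may realise `dA6` itself.

HELPER of the crux item `stmt-ValiantsHypothesis-18050` (supports only); nothing here is new mathematics, bears on the crux, or on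
`VP ≠ VNP`.  [folklore] bookkeeping; no citation needed.
-/

-- `Summit.ValiantsHypothesis.ValiantsHypothesis.…` repeats a component by the D-0017 layout
-- (single-conjunct summit), which the `dupNamespace` linter flags; the name is mandated.
set_option linter.dupNamespace false

namespace Summit.ValiantsHypothesis.ValiantsHypothesis.Theorems.LacunarySymmetroidMatrixDescartes.FiniteSector

open scoped BigOperators Matrix
open Polynomial

/-- **Closer for `finite.lean`'s `stub_F7_two_six`** — the statement of the stub, verbatim in Theorems-side vocabulary
(`pencil`, `IsFullPosRooted` of `…FiniteSectorDefs` = the workfile's verbatim copies): a symmetric `2 × 2` half-pencil on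
`(0,1,3,5,7,8)` with a full-positive-rooted determinant of degree `16` (`ν(2,6) = 16 = n(2,5)`, hence `η(2,6) = 32`).
By name from `fullyRealisable_two_013578_16`. [folklore] -/
theorem stub_F7_two_six_closer :
    ∃ S : Fin 6 → Matrix (Fin 2) (Fin 2) ℝ, (∀ l, (S l).IsSymm) ∧
      IsFullPosRooted (pencil (![0, 1, 3, 5, 7, 8] : Fin 6 → ℕ) S).det ∧
      (pencil (![0, 1, 3, 5, 7, 8] : Fin 6 → ℕ) S).det.natDegree = 16 :=
  fullyRealisable_two_013578_16

end Summit.ValiantsHypothesis.ValiantsHypothesis.Theorems.LacunarySymmetroidMatrixDescartes.FiniteSector
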